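import Mathlib
import Summits.Ventures.HodgeRepro.PeriodCloserC7Chain

/-!
# PeriodCloserC7Model — the chain hypotheses are consistent (a toy instantiation)

Blind re-derivation cell `pub-hodge-repro`, seat night-2 (gen 0).  Target tree path
`lean/Summits/Ventures/HodgeRepro/PeriodCloserC7Model.lean`.

A theorem over an interface is vacuous if its hypotheses are contradictory.  This file rules that out for
`ChainHypotheses I` (`PeriodCloserC7.lean`) by exhibiting, for every CM field `L`, a TOY instantiation
`toyFace L : C7Face L` satisfying all of them: one place, the "Hecke characters" are the signs `ℤˣ` with the
root number the sign itself and the flip the negation, every central value `1`, the data are the sign vectors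
`Fin 4 → ℤˣ` with the even ones admissible, all automorphic predicates true and both numbers of the
identification equal to `1`.  Then `S4face_of_chain` applies and returns the toy `S4face = True`.

This is a consistency check of the LOGICAL FORM of the hypotheses and nothing more: the toy has no
automorphic content, and the theorem `chainHypotheses_satisfiable` says only that the hypothesis set of the
chain is not self-contradictory.  Nothing here says anything about the status of the Hodge conjecture for CM
abelian varieties, which is NOT proved.
-/

set_option autoImplicit false

noncomputable section

namespace Summit.Ventures.HodgeRepro.PeriodCloser

open NumberField

variable (L : Type) [Field L] [NumberField L] [IsCMField L]

/-- The trivial seesaw datum: four lines of discriminant `1`, the identity isometry. -/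
def toySeesaw : MuTable.SeesawDatum L where
  a := fun _ => 1
  a_real := fun _ => map_one _
  a_ne := fun _ => one_ne_zero
  iso := ⟨1, by
    have h1 : ((1 : Matrix (Fin 2) (Fin 2) L).map (NumberField.IsCMField.complexConj L)) = 1 :=
      Matrix.map_one _ (map_zero _) (map_one _)
    simp [h1]⟩

/-- **The toy face**: signs as characters, the root number the sign, the flip the negation, even sign vectors
as admissible data, everything automorphic true. -/
abbrev toyFace : C7Face L where
  Place := Unit
  IsSplit := fun _ => True
  IsUnramified := fun _ => True
  HeckeChar := ℤˣ
  IsSelfDual := fun _ => True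
  rootNumber := id
  localRootNumber := fun _ χ => χ
  centralValue := fun _ => 1
  Xi := fun _ => ℕ
  twist := fun _ χ _ => χ
  flip := fun χ => -χ
  seesaw := toySeesaw L
  S4face := True
  WeilPeriodWitness := True
  Datum := Fin 4 → ℤˣ
  Admissible := fun d => d 0 * d 1 = d 2 * d 3
  chars := id
  hodgePairing := fun _ => 1
  torusPeriod := fun _ => 1
  Tau := Unit
  U1Char := Unit
  thetaLift := fun _ => ()
  betaOf := fun _ => ()
  toricPeriodNonzero := fun _ _ _ => True
  liftNonzero := fun _ => True
  Compat := fun _ _ => True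
  LocalRootCond := fun _ _ _ => True

/-- The toy satisfies the identification (both numbers are `1`; (P) and (P′) both hold). -/
theorem toy_identification : Identification (toyFace L) :=
  ⟨fun _ => rfl, ⟨fun _ => ⟨fun _ => 1, (), fun _ => trivial, trivial⟩, fun _ => ⟨fun _ => 1, one_ne_zero⟩⟩⟩

/-- The toy satisfies Tate's product formula (one place). -/
theorem toy_productFormula : ProductFormula (toyFace L) :=
  ⟨fun _ => Set.toFinite _, fun χ => by
    show χ = ∏ᶠ _ : Unit, χ
    rw [finprod_unique]⟩

/-- Flipping an N2-compatible pattern of an even sign vector gives an even sign vector. -/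
theorem toy_flip_even (d : Fin 4 → ℤˣ) (J : Fin 4 → Bool) (hd : d 0 * d 1 = d 2 * d 3) (hJ : N2compat J) :
    flipOn (toyFace L) d J 0 * flipOn (toyFace L) d J 1 = flipOn (toyFace L) d J 2 * flipOn (toyFace L) d J 3 := by
  unfold N2compat at hJ
  simp only [flipOn]
  revert hJ
  cases h0 : J 0 <;> cases h1 : J 1 <;> cases h2 : J 2 <;> cases h3 : J 3 <;> intro hJ <;>
    simp at hJ <;> simp [hd]

/-- The toy admissible family: base `(1,1,1,1)`, closure under N2-compatible flips and (trivial) twists. -/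
theorem toy_family : AdmissibleFamily (toyFace L) where
  base := ⟨fun _ => 1, rfl⟩
  selfDual := fun _ _ _ => trivial
  flip_mem := fun d J hd hJ => ⟨flipOn (toyFace L) d J, toy_flip_even L d J hd hJ, rfl⟩
  split := ⟨(), trivial⟩
  twist_mem := fun d _ _ hd _ => ⟨d, hd, rfl⟩

/-- **The chain hypotheses are satisfiable**: the toy face satisfies every one of them. -/
theorem toy_chainHypotheses : ChainHypotheses (toyFace L) where
  ident := toy_identification L
  lemmaPi := Iff.rfl
  witness := fun _ => trivial
  tp1 := fun _ _ => ⟨fun _ => ⟨trivial, fun _ => trivial, mul_ne_zero one_ne_zero one_ne_zero⟩, fun _ => trivial⟩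
  bhty := fun _ _ _ _ => by
    refine Set.Finite.subset (Set.finite_empty) fun ν hν => ?_
    exact absurd hν.2 one_ne_zero
  bhtySplit := fun _ _ _ _ => by
    refine Set.Finite.subset (Set.finite_empty) fun ν hν => ?_
    exact hν rfl
  xi := ⟨fun _ => inferInstanceAs (Infinite ℕ), fun _ _ => trivial⟩
  productFormula := toy_productFormula L
  flip := fun _ _ => rfl
  discharge := ⟨fun _ _ _ => trivial, fun _ _ _ _ _ => trivial, fun _ hd _ => hd, fun _ _ => trivial⟩
  family := toy_family L

/-- **Non-vacuity of the chain**: for every CM field `L` there is an instantiation of the interface satisfying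
`ChainHypotheses` — the hypothesis set of `S4face_of_chain` is not self-contradictory. -/
theorem chainHypotheses_satisfiable : ∃ I : C7Face L, ChainHypotheses I :=
  ⟨toyFace L, toy_chainHypotheses L⟩

/-- The chain theorem applied to the toy returns its (trivial) conclusion. -/
theorem toy_S4face : (toyFace L).S4face :=
  S4face_of_chain' (toyFace L) (toy_chainHypotheses L)

end Summit.Ventures.HodgeRepro.PeriodCloser

end
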